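import Mathlib
import Literature.Analysis.FluidPDE.LongTimeAverageNonneg
import Summits.AnomalousDissipation.AnomalousDissipation.Theorems.TwoAndHalfDTwohalfdThesisStubDissipationFloor

/-!
# D2' `stub_dissipationFloorOfMeanVariance`: the dissipation floor from an integrated variance bound

Stub D2' of the line `budgeted-mixer-template` (reshape r2) for the crux
`Summit.AnomalousDissipation.AnomalousDissipation.Theses.TwoAndHalfD.ScalarAnomalySteadySourceFormal`
(stmt-AnomalousDissipation-0448); the statement is registered verbatim in the line's checked
skeleton and is consumed by the kernel-checked composition there.  It is the MEAN-VARIANCE twin of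
the landed D2 `TwohalfdThesis.stub_dissipationFloor` (pointwise variance bound `‖θ(t)‖² ≤ B`),
whose file supplies the sourced `L²` balance in Cesàro form (`dissipationFloor_timeMean_eq`).

CONTENT.  Let `θ` be a classical solution of the sourced advection–diffusion equation
`∂ₜθ + u·∇θ = κΔθ + h` on `[0, ∞) × T²` (`κ ≥ 0`, steady smooth source `h`) with the INTEGRATED
variance bound `∫₀ᵀ ‖θ(t)‖²_{L²} dt ≤ a + bT` (`T ≥ 0`) and a liminf floor on the power means,
`ε ≤ liminf_T T⁻¹∫₀ᵀ P`, `P(t) := ∫ h θ(t)`.  Then the limsup-mean dissipation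
`⟨κ‖∇θ‖²⟩ = limsup_T T⁻¹∫₀ᵀ κ‖∇θ(t)‖²` (spectral gradient norm `Torus.eScalarGradNormSq`, `toReal`)
is `≥ ε`.

PROOF.  Write `e(t) = ‖θ(t)‖²`, `N = ‖h‖²`, `L = √N + 1`.
(1) GROWTH (`meanVariance_sqrt_succ_sub_le`).  The sourced balance
`e' = -2κ‖∇θ‖² + 2P ≤ 2√N √e` within `[0, ∞)` (`ColdStartVariance.forced_hasDerivWithinAt_scalarL2Sq`,
Cauchy–Schwarz `ColdStartVariance.integral_mul_le_sqrt_mul_sqrt`) makes `t ↦ √(e(t)+1) - Lt`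
non-increasing on `[0, ∞)` (Mathlib `antitoneOn_of_hasDerivWithinAt_nonpos`), i.e.
`√(e(t)+1) ≥ √(e(T)+1) - L(T-t)` for `0 ≤ t ≤ T`.
(2) SUBLINEARITY (`meanVariance_eventually_le_mul`, real-variable).  Put `ρ = √(e(T)+1)`, so
`ρ ≤ √(e(0)+1) + LT ≤ 2LT` for `T ≥ √(e(0)+1)/L`, and `ℓ = ρ/(2L) ≤ T`.  On `[T-ℓ, T]`,
`√(e+1) ≥ ρ/2`, whence `ℓρ²/4 ≤ ∫_{T-ℓ}^{T} (e+1) ≤ a + bT + ℓ`; thus `ρ³ ≤ 8L(a+bT) + 4ρ ≤ KT`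
(`T ≥ 1`).  If `e(T) > δT` with `T ≥ K²/δ³` then `ρ > K/δ` and `ρ³ > ρ·δT > KT`, a contradiction:
so `e(T) ≤ δT` eventually, for every `δ > 0` (`‖θ(T)‖² = o(T)`).
(3) POWER MEANS.  `|P| ≤ √N√e ≤ (√N/2)(e+1)`, so `|T⁻¹∫₀ᵀ P| ≤ (√N/2)(a/T + b + 1) ≤ (√N/2)(a+b+1)`
for `T ≥ 1` (`intervalIntegral.norm_integral_le_of_norm_le`).
(4) BOOKKEEPING (`meanVariance_le_limsup`).  By `dissipationFloor_timeMean_eq`,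
`T⁻¹∫₀ᵀ κ‖∇θ‖² = T⁻¹∫₀ᵀ P - (e(T) - e(0))/(2T)`: the dissipation means are bounded above, the power
means bounded below, and for `δ > 0` eventually `T⁻¹∫₀ᵀ κ‖∇θ‖² ≥ T⁻¹∫₀ᵀ P - δ`, so
`Filter.eventually_lt_of_lt_liminf` and `Filter.le_limsup_of_frequently_le` give `ε - 2δ ≤ limsup`.
Supports stmt-AnomalousDissipation-0448. [folklore: Doering–Foias 2002, §2 (power balance in
Cesàro form); DEIJ 2022, (1.2); Shaw–Thiffeault–Doering 2007, (I.11) (linear variance growth)]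
-/

noncomputable section

-- the summit path `AnomalousDissipation/AnomalousDissipation` duplicates a namespace component
set_option linter.dupNamespace false

namespace Summit.AnomalousDissipation.AnomalousDissipation.Theorems.ScalarAnomalySteadySourceFormal.DissipationFloorOfMeanVariance

open MeasureTheory Set Filter Topology
open scoped ENNReal NNReal InnerProductSpace
open Literature.Analysis.FunctionSpaces Literature.Analysis.FluidPDE

/-! ## Real-variable lemmas -/

/-- **Cesàro bookkeeping with `o(1)` corrections.** If the means `m` are eventually bounded below,
the means `n` eventually bounded above, `n T ≥ m T - δ` eventually for every `δ > 0`, and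
`ε ≤ liminf m`, then `ε ≤ limsup n` (all along `atTop` in `ℝ`; the bounds make both the `liminf`
and the `limsup` honest): for `δ > 0`, eventually `m T > ε - δ/2`
(`Filter.eventually_lt_of_lt_liminf`), so eventually `n T ≥ ε - δ`, whence `ε - δ ≤ limsup n`
(`Filter.le_limsup_of_frequently_le`). [folklore] -/
theorem meanVariance_le_limsup {m n : ℝ → ℝ} {ε : ℝ} (hm : IsBoundedUnder (· ≥ ·) atTop m)
    (hn : IsBoundedUnder (· ≤ ·) atTop n) (hlow : ∀ δ, 0 < δ → ∀ᶠ T in atTop, m T - δ ≤ n T)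
    (hε : ε ≤ liminf m atTop) : ε ≤ limsup n atTop := by
  refine le_of_forall_pos_le_add fun δ hδ => ?_
  rw [← sub_le_iff_le_add]
  have h1 : ∀ᶠ T in atTop, ε - δ / 2 < m T :=
    eventually_lt_of_lt_liminf (lt_of_lt_of_le (by linarith) hε) hm
  have h2 : ∀ᶠ T in atTop, ε - δ ≤ n T := by
    filter_upwards [h1, hlow (δ / 2) (half_pos hδ)] with T hT1 hT2
    linarith
  exact le_limsup_of_frequently_le h2.frequently hn

/-- **One-sided Lipschitz bound for `√(e + 1)`.** If `e ≥ 0` has derivative `e'` within `[0, ∞)`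
with `e' ≤ 2L√e` (`L ≥ 0`), then `t ↦ √(e(t) + 1) - Lt` is non-increasing on `[0, ∞)`
(`d/dt √(e+1) = e'/(2√(e+1)) ≤ L`; Mathlib `antitoneOn_of_hasDerivWithinAt_nonpos`), i.e.
`√(e(T) + 1) - L(T - t) ≤ √(e(t) + 1)` for `0 ≤ t ≤ T` (Shaw–Thiffeault–Doering 2007, (I.11):
the variance of a sourced scalar grows at most linearly). [folklore] -/
theorem meanVariance_sqrt_succ_sub_le {e e' : ℝ → ℝ} {L : ℝ} (hL : 0 ≤ L) (he : ∀ t, 0 ≤ e t)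
    (hder : ∀ t ∈ Ici (0 : ℝ), HasDerivWithinAt e (e' t) (Ici 0) t)
    (hbound : ∀ t ∈ Ici (0 : ℝ), e' t ≤ 2 * L * √(e t)) {t T : ℝ} (ht : 0 ≤ t) (htT : t ≤ T) :
    √(e T + 1) - L * (T - t) ≤ √(e t + 1) := by
  set G : ℝ → ℝ := fun τ => √(e τ + 1) - τ * L with hG_def
  have hconv : Convex ℝ (Ici (0 : ℝ)) := convex_Ici 0
  have hcont : ContinuousOn e (Ici 0) := fun τ hτ => (hder τ hτ).continuousWithinAt
  have hGcont : ContinuousOn G (Ici 0) :=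
    (hcont.add continuousOn_const).sqrt.sub (continuousOn_id.mul continuousOn_const)
  have hGder : ∀ x ∈ interior (Ici (0 : ℝ)),
      HasDerivWithinAt G (e' x / (2 * √(e x + 1)) - L) (interior (Ici 0)) x := by
    intro x hx
    rw [interior_Ici] at hx ⊢
    have hxI : x ∈ Ici (0 : ℝ) := mem_Ici.2 (le_of_lt hx)
    have hne : e x + 1 ≠ 0 := (add_pos_of_nonneg_of_pos (he x) one_pos).ne'
    have h1 : HasDerivWithinAt (fun τ => e τ + 1) (e' x) (Ici 0) x := (hder x hxI).add_const 1
    have h2 := h1.sqrt hne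
    have h3 : HasDerivWithinAt (fun τ => τ * L) (1 * L) (Ici 0) x :=
      (hasDerivWithinAt_id x _).mul_const L
    have h4 := (h2.sub h3).mono (Ioi_subset_Ici_self (a := (0 : ℝ)))
    rw [one_mul] at h4
    exact h4
  have hGnonpos : ∀ x ∈ interior (Ici (0 : ℝ)), e' x / (2 * √(e x + 1)) - L ≤ 0 := by
    intro x hx
    rw [interior_Ici] at hx
    have hxI : x ∈ Ici (0 : ℝ) := mem_Ici.2 (le_of_lt hx)
    have hpos : 0 < 2 * √(e x + 1) :=
      mul_pos two_pos (Real.sqrt_pos.2 (add_pos_of_nonneg_of_pos (he x) one_pos))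
    have hmono : √(e x) ≤ √(e x + 1) := Real.sqrt_le_sqrt (by linarith)
    have hmono' : L * √(e x) ≤ L * √(e x + 1) := mul_le_mul_of_nonneg_left hmono hL
    rw [sub_nonpos, div_le_iff₀ hpos]
    linarith [hbound x hxI]
  have hanti := antitoneOn_of_hasDerivWithinAt_nonpos hconv hGcont hGder hGnonpos
  have hle : G T ≤ G t := hanti (mem_Ici.2 ht) (mem_Ici.2 (ht.trans htT)) htT
  simp only [hG_def] at hle
  linarith

/-- **Sublinear growth from an integrated bound.** Let `e ≥ 0` be continuous on `[0, ∞)` with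
`√(e(T) + 1) - L(T - t) ≤ √(e(t) + 1)` for `0 ≤ t ≤ T` (`L > 0`) and `∫₀ᵀ e ≤ a + bT` for
`T ≥ 0`.  Then `e(T) ≤ δT` eventually, for every `δ > 0` (`e(T) = o(T)`): with `ρ = √(e(T)+1)`
and `ℓ = ρ/(2L) ≤ T` (for `T ≥ √(e(0)+1)/L`), `√(e+1) ≥ ρ/2` on `[T-ℓ, T]`, so
`ℓρ²/4 ≤ ∫_{T-ℓ}^{T}(e+1) ≤ a + bT + ℓ`, `ρ³ ≤ 8L(a+bT) + 4ρ ≤ KT` (`T ≥ 1`), which is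
incompatible with `ρ² > δT` once `T ≥ K²/δ³`. [folklore] -/
theorem meanVariance_eventually_le_mul {e : ℝ → ℝ} {L a b : ℝ} (hL : 0 < L) (he : ∀ t, 0 ≤ e t)
    (hcont : ContinuousOn e (Ici 0))
    (hlip : ∀ t T, 0 ≤ t → t ≤ T → √(e T + 1) - L * (T - t) ≤ √(e t + 1))
    (hint : ∀ T, 0 ≤ T → ∫ t in (0 : ℝ)..T, e t ≤ a + b * T) {δ : ℝ} (hδ : 0 < δ) :
    ∀ᶠ T in atTop, e T ≤ δ * T := by
  have ha : 0 ≤ a := by simpa using hint 0 le_rfl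
  set F0 : ℝ := √(e 0 + 1) with hF0_def
  have hF0 : 0 ≤ F0 := Real.sqrt_nonneg _
  set K : ℝ := 8 * L * a + 4 * F0 + (8 * L * b + 4 * L) with hK_def
  filter_upwards [eventually_ge_atTop (1 : ℝ), eventually_ge_atTop (F0 / L),
    eventually_ge_atTop (K ^ 2 / δ ^ 3)] with T hT1 hTF hTK
  have hT0 : 0 < T := by linarith
  by_contra hcon
  push Not at hcon
  -- `ρ = √(e T + 1)`, `ℓ = ρ / (2L)`
  set ρ : ℝ := √(e T + 1) with hρ_def
  have heT1 : 0 < e T + 1 := by linarith [he T]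
  have hρpos : 0 < ρ := Real.sqrt_pos.2 heT1
  have hρsq : ρ ^ 2 = e T + 1 := Real.sq_sqrt heT1.le
  have hρle : ρ ≤ F0 + L * T := by
    have h := hlip 0 T le_rfl hT0.le
    rw [sub_zero] at h
    linarith
  have hF0T : F0 ≤ L * T := by
    rw [div_le_iff₀ hL] at hTF
    linarith
  set ℓ : ℝ := ρ / (2 * L) with hℓ_def
  have h2L : 0 < 2 * L := by positivity
  have hℓpos : 0 < ℓ := div_pos hρpos h2L
  have hLℓ : L * ℓ = ρ / 2 := by
    rw [hℓ_def]
    field_simp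
  have hℓT : ℓ ≤ T := by
    rw [hℓ_def, div_le_iff₀ h2L]
    nlinarith
  -- on `[T - ℓ, T]` the regularised root is at least `ρ / 2`
  have hlow : ∀ t ∈ Icc (T - ℓ) T, ρ ^ 2 / 4 ≤ e t + 1 := by
    intro t ht
    have ht0 : 0 ≤ t := by linarith [ht.1]
    have h1 := hlip t T ht0 ht.2
    have h2 : L * (T - t) ≤ L * ℓ := mul_le_mul_of_nonneg_left (by linarith [ht.1]) hL.le
    have h3 : ρ / 2 ≤ √(e t + 1) := by linarith
    have h4 : (ρ / 2) ^ 2 ≤ e t + 1 :=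
      (Real.le_sqrt (by linarith) (by linarith [he t])).1 h3
    have h5 : (ρ / 2) ^ 2 = ρ ^ 2 / 4 := by ring
    linarith
  -- integrate over `[T - ℓ, T]`
  have hsubI : Icc (T - ℓ) T ⊆ Ici 0 := fun t ht => mem_Ici.2 (by linarith [ht.1])
  have hTℓ : T - ℓ ≤ T := by linarith
  have heI : IntervalIntegrable e volume (T - ℓ) T := by
    refine ContinuousOn.intervalIntegrable ?_
    rw [uIcc_of_le hTℓ]
    exact hcont.mono hsubI
  have he1I : IntervalIntegrable (fun t => e t + 1) volume (T - ℓ) T := by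
    refine ContinuousOn.intervalIntegrable ?_
    rw [uIcc_of_le hTℓ]
    exact (hcont.mono hsubI).add continuousOn_const
  have hI1 : ∫ _ in (T - ℓ)..T, ρ ^ 2 / 4 ≤ ∫ t in (T - ℓ)..T, (e t + 1) :=
    intervalIntegral.integral_mono_on hTℓ intervalIntegrable_const he1I hlow
  rw [intervalIntegral.integral_const, smul_eq_mul] at hI1
  have hI2 : ∫ t in (T - ℓ)..T, (e t + 1) = (∫ t in (T - ℓ)..T, e t) + ℓ := by
    rw [intervalIntegral.integral_add heI intervalIntegrable_const, intervalIntegral.integral_const,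
      smul_eq_mul, mul_one]
    ring
  have he0I : IntervalIntegrable e volume 0 T := by
    refine ContinuousOn.intervalIntegrable ?_
    rw [uIcc_of_le hT0.le]
    exact hcont.mono Icc_subset_Ici_self
  have hI3 : ∫ t in (T - ℓ)..T, e t ≤ ∫ t in (0 : ℝ)..T, e t :=
    intervalIntegral.integral_mono_interval (by linarith) hTℓ le_rfl
      (Eventually.of_forall fun t => he t) he0I
  have hI4 := hint T hT0.le
  have hmain : ℓ * (ρ ^ 2 / 4) ≤ a + b * T + ℓ := by
    have h : (T - (T - ℓ)) * (ρ ^ 2 / 4) = ℓ * (ρ ^ 2 / 4) := by ring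
    linarith
  -- `ρ³ ≤ K T`
  have h8L : 0 < 8 * L := by positivity
  have e1 : ℓ * (ρ ^ 2 / 4) * (8 * L) = ρ ^ 3 := by
    rw [hℓ_def]
    field_simp
    ring
  have e2 : (a + b * T + ℓ) * (8 * L) = 8 * L * a + 8 * L * b * T + 4 * ρ := by
    rw [hℓ_def]
    field_simp
    ring
  have hρ3 : ρ ^ 3 ≤ 8 * L * a + 8 * L * b * T + 4 * ρ := by
    have h := mul_le_mul_of_nonneg_right hmain h8L.le
    rwa [e1, e2] at h
  have hC0 : 8 * L * a + 4 * F0 ≤ (8 * L * a + 4 * F0) * T := by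
    have h0 : 0 ≤ 8 * L * a + 4 * F0 := by positivity
    nlinarith
  have hρK : ρ ^ 3 ≤ K * T := by
    rw [hK_def]
    nlinarith
  -- the contradiction: `ρ > K / δ` and `ρ² > δ T`
  have hKρ : K / δ < ρ := by
    apply Real.lt_sqrt_of_sq_lt
    have h1 : (K / δ) ^ 2 = K ^ 2 / δ ^ 3 * δ := by
      field_simp
    have h2 : K ^ 2 / δ ^ 3 * δ ≤ T * δ := mul_le_mul_of_nonneg_right hTK hδ.le
    nlinarith
  have hδT : 0 < δ * T := mul_pos hδ hT0
  have h1 : δ * T * (K / δ) < δ * T * ρ := mul_lt_mul_of_pos_left hKρ hδT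
  have h2 : δ * T * (K / δ) = K * T := by
    field_simp
  have h3 : δ * T * ρ < ρ ^ 2 * ρ := mul_lt_mul_of_pos_right (by linarith) hρpos
  have h4 : ρ ^ 2 * ρ = ρ ^ 3 := by ring
  linarith

/-! ## The stub -/

/-- **D2' `stub_dissipationFloorOfMeanVariance` (line `budgeted-mixer-template`, crux
`TwoAndHalfD.ScalarAnomalySteadySourceFormal`).**  For a classical solution `θ` of
`∂ₜθ + u·∇θ = κΔθ + h` on `[0, ∞) × T²` (`κ ≥ 0`, `h` smooth) with the integrated variance bound
`∫₀ᵀ ‖θ(t)‖²_{L²} dt ≤ a + bT` (`T ≥ 0`) and a liminf-mean input-power floor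
`ε ≤ liminf_T T⁻¹∫₀ᵀ ∫ h θ(t)`, the limsup-mean dissipation `⟨κ‖∇θ‖²⟩` (spectral gradient norm,
`toReal`) is `≥ ε`: the sourced `L²` balance in Cesàro form
(`TwohalfdThesis.dissipationFloor_timeMean_eq`) reads
`T⁻¹∫₀ᵀ κ‖∇θ‖² = T⁻¹∫₀ᵀ ∫ h θ - (‖θ(T)‖² - ‖θ(0)‖²)/(2T)`, where `‖θ(T)‖² = o(T)`
(`meanVariance_sqrt_succ_sub_le`, `meanVariance_eventually_le_mul`) and the power means are
bounded (`|∫ h θ| ≤ ‖h‖‖θ‖ ≤ (‖h‖/2)(‖θ‖² + 1)`); the bookkeeping `meanVariance_le_limsup`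
concludes (Doering–Foias 2002, §2). [folklore] -/
theorem stub_dissipationFloorOfMeanVariance :
    ∀ (κ a b ε : ℝ) (u : ℝ → UnitAddTorus (Fin 2) → EuclideanSpace ℝ (Fin 2)) (h : UnitAddTorus (Fin 2) → ℝ)
      (θ : ℝ → UnitAddTorus (Fin 2) → ℝ),
      0 ≤ κ → Torus.IsSmooth h →
      Torus.IsClassicalScalarTransportForcedOn (Set.Ici 0) κ u (fun _ => h) θ →
      (∀ T, 0 ≤ T → ∫ t in (0 : ℝ)..T, Torus.scalarL2Sq (θ t) ≤ a + b * T) →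
      ε ≤ liminf (timeMean fun t => ∫ x, h x * θ t x) atTop →
      ε ≤ longTimeAvgSup (fun t => κ * (Torus.eScalarGradNormSq (θ t)).toReal) := by
  intro κ a b ε u h θ hκ hh hθ hInt hε
  have hconv : Convex ℝ (Ici (0 : ℝ)) := convex_Ici 0
  have he0 : ∀ t, 0 ≤ Torus.scalarL2Sq (θ t) := fun t => Torus.scalarL2Sq_nonneg _
  have hN0 : 0 ≤ √(Torus.scalarL2Sq h) := Real.sqrt_nonneg _
  have ha : 0 ≤ a := by simpa using hInt 0 le_rfl
  -- (1) the sourced balance within `[0, ∞)` and the growth bound `e' ≤ 2 √N √e ≤ 2 (√N + 1) √e`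
  have hder : ∀ t ∈ Ici (0 : ℝ), HasDerivWithinAt (fun τ => Torus.scalarL2Sq (θ τ))
      (-(2 * κ) * Torus.scalarGradNormSq (θ t) + 2 * ∫ x, θ t x * h x) (Ici 0) t := fun t ht =>
    ScalarAnomalySteadySourceFormal.ColdStartVariance.forced_hasDerivWithinAt_scalarL2Sq hθ hconv ht
  have hcont : ContinuousOn (fun t => Torus.scalarL2Sq (θ t)) (Ici 0) := fun t ht =>
    (hder t ht).continuousWithinAt
  have hbound : ∀ t ∈ Ici (0 : ℝ), -(2 * κ) * Torus.scalarGradNormSq (θ t) + 2 * ∫ x, θ t x * h x ≤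
      2 * (√(Torus.scalarL2Sq h) + 1) * √(Torus.scalarL2Sq (θ t)) := by
    intro t ht
    have hθt : Torus.IsSmooth (θ t) := hθ.smooth_scalar.isSmooth_slice ht
    have h1 : ∫ x, θ t x * h x ≤ √(Torus.scalarL2Sq (θ t)) * √(Torus.scalarL2Sq h) :=
      ScalarAnomalySteadySourceFormal.ColdStartVariance.integral_mul_le_sqrt_mul_sqrt
        (hθt.memLp 2) (hh.memLp 2)
    have h2 : 0 ≤ 2 * κ * Torus.scalarGradNormSq (θ t) :=
      mul_nonneg (mul_nonneg two_pos.le hκ) (Torus.scalarGradNormSq_nonneg _)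
    have h3 : 0 ≤ √(Torus.scalarL2Sq (θ t)) := Real.sqrt_nonneg _
    nlinarith
  have hlip : ∀ t T, 0 ≤ t → t ≤ T →
      √(Torus.scalarL2Sq (θ T) + 1) - (√(Torus.scalarL2Sq h) + 1) * (T - t) ≤
        √(Torus.scalarL2Sq (θ t) + 1) := fun t T ht htT =>
    meanVariance_sqrt_succ_sub_le (by positivity) he0 hder hbound ht htT
  -- (2) sublinearity of the variance
  have hsub : ∀ δ, 0 < δ → ∀ᶠ T in atTop, Torus.scalarL2Sq (θ T) ≤ δ * T := fun δ hδ =>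
    meanVariance_eventually_le_mul (by positivity) he0 hcont hlip hInt hδ
  -- (3) the power means are bounded: `|P| ≤ √N √e ≤ (√N / 2) (e + 1)`
  have hPabs : ∀ t, 0 ≤ t →
      |∫ x, h x * θ t x| ≤ √(Torus.scalarL2Sq h) / 2 * (Torus.scalarL2Sq (θ t) + 1) := by
    intro t ht
    have hθt : Torus.IsSmooth (θ t) := hθ.smooth_scalar.isSmooth_slice (mem_Ici.2 ht)
    have h1 : ∫ x, h x * θ t x ≤ √(Torus.scalarL2Sq h) * √(Torus.scalarL2Sq (θ t)) :=
      ScalarAnomalySteadySourceFormal.ColdStartVariance.integral_mul_le_sqrt_mul_sqrt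
        (hh.memLp 2) (hθt.memLp 2)
    have h2 := ScalarAnomalySteadySourceFormal.ColdStartVariance.integral_mul_le_sqrt_mul_sqrt
      (hh.memLp 2).neg (hθt.memLp 2)
    simp only [Pi.neg_apply, neg_mul, integral_neg, neg_sq] at h2
    have h2' : -∫ x, h x * θ t x ≤ √(Torus.scalarL2Sq h) * √(Torus.scalarL2Sq (θ t)) := h2
    have h3 : 2 * √(Torus.scalarL2Sq (θ t)) ≤ Torus.scalarL2Sq (θ t) + 1 := by
      nlinarith [Real.sq_sqrt (he0 t), sq_nonneg (√(Torus.scalarL2Sq (θ t)) - 1),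
        Real.sqrt_nonneg (Torus.scalarL2Sq (θ t))]
    have h4 : √(Torus.scalarL2Sq h) * √(Torus.scalarL2Sq (θ t)) ≤
        √(Torus.scalarL2Sq h) / 2 * (Torus.scalarL2Sq (θ t) + 1) := by
      nlinarith
    rw [abs_le]
    exact ⟨by linarith, by linarith⟩
  have hm : ∀ T, 1 ≤ T →
      |timeMean (fun t => ∫ x, h x * θ t x) T| ≤ √(Torus.scalarL2Sq h) / 2 * (a + b + 1) := by
    intro T hT1
    have hT : 0 < T := by linarith
    have hsubI : uIcc 0 T ⊆ Ici 0 := by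
      rw [uIcc_of_le hT.le]
      exact Icc_subset_Ici_self
    have heI : IntervalIntegrable (fun t => Torus.scalarL2Sq (θ t)) volume 0 T :=
      (hcont.mono hsubI).intervalIntegrable
    have hgI : IntervalIntegrable
        (fun t => √(Torus.scalarL2Sq h) / 2 * (Torus.scalarL2Sq (θ t) + 1)) volume 0 T :=
      (continuousOn_const.mul ((hcont.mono hsubI).add continuousOn_const)).intervalIntegrable
    have hnorm : ‖∫ t in (0 : ℝ)..T, ∫ x, h x * θ t x‖ ≤
        ∫ t in (0 : ℝ)..T, √(Torus.scalarL2Sq h) / 2 * (Torus.scalarL2Sq (θ t) + 1) :=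
      intervalIntegral.norm_integral_le_of_norm_le hT.le
        (Eventually.of_forall fun t ht => by
          rw [Real.norm_eq_abs]
          exact hPabs t ht.1.le) hgI
    have hval : ∫ t in (0 : ℝ)..T, √(Torus.scalarL2Sq h) / 2 * (Torus.scalarL2Sq (θ t) + 1) =
        √(Torus.scalarL2Sq h) / 2 * ((∫ t in (0 : ℝ)..T, Torus.scalarL2Sq (θ t)) + T) := by
      rw [intervalIntegral.integral_const_mul, intervalIntegral.integral_add heI
        intervalIntegrable_const, intervalIntegral.integral_const, smul_eq_mul, sub_zero, mul_one]
    rw [hval] at hnorm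
    have hI := hInt T hT.le
    have hle : ‖∫ t in (0 : ℝ)..T, ∫ x, h x * θ t x‖ ≤
        √(Torus.scalarL2Sq h) / 2 * (a + b * T + T) := by
      have h1 : √(Torus.scalarL2Sq h) / 2 * ((∫ t in (0 : ℝ)..T, Torus.scalarL2Sq (θ t)) + T) ≤
          √(Torus.scalarL2Sq h) / 2 * (a + b * T + T) :=
        mul_le_mul_of_nonneg_left (by linarith) (by positivity)
      exact hnorm.trans h1
    unfold timeMean
    rw [abs_mul, abs_inv, abs_of_pos hT, ← Real.norm_eq_abs]
    calc T⁻¹ * ‖∫ t in (0 : ℝ)..T, ∫ x, h x * θ t x‖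
        ≤ T⁻¹ * (√(Torus.scalarL2Sq h) / 2 * (a + b * T + T)) :=
          mul_le_mul_of_nonneg_left hle (inv_nonneg.2 hT.le)
      _ = √(Torus.scalarL2Sq h) / 2 * (a * T⁻¹ + b + 1) := by
          field_simp
      _ ≤ √(Torus.scalarL2Sq h) / 2 * (a + b + 1) := by
          have h1 : a * T⁻¹ ≤ a := by
            rw [mul_inv_le_iff₀ hT]
            nlinarith
          have h2 : 0 ≤ √(Torus.scalarL2Sq h) / 2 := by positivity
          nlinarith [mul_le_mul_of_nonneg_left h1 h2]
  -- (4) bookkeeping with the Cesàro-form balance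
  have hm_bdd : IsBoundedUnder (· ≥ ·) atTop (timeMean fun t => ∫ x, h x * θ t x) :=
    ⟨-(√(Torus.scalarL2Sq h) / 2 * (a + b + 1)),
      (eventually_ge_atTop (1 : ℝ)).mono fun T hT => (abs_le.1 (hm T hT)).1⟩
  have hn_bdd : IsBoundedUnder (· ≤ ·) atTop
      (timeMean fun t => κ * (Torus.eScalarGradNormSq (θ t)).toReal) := by
    refine ⟨√(Torus.scalarL2Sq h) / 2 * (a + b + 1) + Torus.scalarL2Sq (θ 0) / 2,
      (eventually_ge_atTop (1 : ℝ)).mono fun T hT1 => ?_⟩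
    have hT : 0 < T := by linarith
    show timeMean (fun t => κ * (Torus.eScalarGradNormSq (θ t)).toReal) T ≤ _
    rw [TwohalfdThesis.dissipationFloor_timeMean_eq hθ hT]
    have h1 : timeMean (fun t => ∫ x, h x * θ t x) T ≤ √(Torus.scalarL2Sq h) / 2 * (a + b + 1) :=
      (le_abs_self _).trans (hm T hT1)
    have h2 : -(Torus.scalarL2Sq (θ 0) / 2) ≤
        (Torus.scalarL2Sq (θ T) - Torus.scalarL2Sq (θ 0)) / (2 * T) := by
      rw [le_div_iff₀ (by positivity)]
      nlinarith [he0 T, he0 0]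
    linarith
  have hlow : ∀ δ, 0 < δ → ∀ᶠ T in atTop, timeMean (fun t => ∫ x, h x * θ t x) T - δ ≤
      timeMean (fun t => κ * (Torus.eScalarGradNormSq (θ t)).toReal) T := by
    intro δ hδ
    filter_upwards [hsub (2 * δ) (by positivity), eventually_gt_atTop (0 : ℝ)] with T hT hT0
    rw [TwohalfdThesis.dissipationFloor_timeMean_eq hθ hT0]
    have h1 : (Torus.scalarL2Sq (θ T) - Torus.scalarL2Sq (θ 0)) / (2 * T) ≤ δ := by
      rw [div_le_iff₀ (by positivity)]
      nlinarith [he0 0]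
    linarith
  unfold longTimeAvgSup
  exact meanVariance_le_limsup hm_bdd hn_bdd hlow hε

end Summit.AnomalousDissipation.AnomalousDissipation.Theorems.ScalarAnomalySteadySourceFormal.DissipationFloorOfMeanVariance

end
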